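import Summits.RiemannHypothesis.RiemannHypothesis.Theorems.TiltedLandingLaw421R3Lens1ToothLiftDichotomy
import Summits.RiemannHypothesis.RiemannHypothesis.Theorems.TiltedLandingLaw421R3Lens1ArcSignH

/-!
# Law 421 — R3, lens 1: the TOOTH–LIFT SPLIT — (G1) companion / (G2) isolated / (G3) defocus, over the landed (ii″)/(iii″) (#1299)

Token 148 «ToothLiftSplit» (director-rh (CA1108)(2), (CA1110), (CA1111)(a), (CA1112), (CA1113); words `M-TARGET-ii2-WORDS-v2.md` 2ef5e041;
critic pre-read l.10136; C2 CHECK l.4200).  TWO imports: #1299 (the laws) and `…R3Lens1ArcSignH` (the DOOR `pinning_of_arcCount_cofinite`).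
The law (ii″) `ToothLiftDichotomyQ θ κ₁ μ ρ` is SPLIT by the census integer `U₀ = 1 + #companions of T` (upper zeros of `f⁽ʲ⁾` other than `T` in
`T`'s CLOSED Jensen disc, any height): **(G1) `CompArcCountQ`** — with a companion (`HasJensenCompanion`), the door's COUNT LAW `ArcCountLaw f j T`
(cofinitely `2(#asc − #desc) ≤ N − 2` on `T`'s Jensen circles; by `disc_census_count` a GLOBAL argument-principle count in which every in-ball
companion is a resource — no per-lens accounting reproduces it, C6 RESULT-11/ADD-1); **(G2) `IsoLiftQ`** — without a companion, the dichotomy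
itself (NL radius `2·Im T`: at the NEG-16 wall the count law is false and only this radius carries the instance); and the (K) GLUE
★`toothLiftDichotomy_of_split : CompArcCountQ → IsoLiftQ → ToothLiftDichotomyQ` through the door BY NAME (`branches_of_door` turns the door's
output into (ii″)'s branches: reflection makes the nested critical point UPPER, the closed base is strictly inside `2·Im T`).  **(G3)
`DefocusOfFrameQ ρ`** is C2's SIGN LAW as a DISCHARGE TARGET (RESULT-7/ADD-2; (CA1110)(2): the laws keep their binders): on a legal frame the
rest factor of `RestFactorZ` is DEFOCUSING (`RVDefocusC`, C2's def verbatim) on `T`'s closed half-disc — the lemma the prover of (iii″)/(G2)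
invokes.  (G1), (G2), (G3) are OPEN, asserted by nothing; the file proves only (K)-glue; RH is not addressed.
-/



namespace RhW08.Lens1ToothNestUmbrella

open RhIdea6.G17.W07C7 RhIdea6.G17.W07C7.Rev6 RhIdea6.G18.W07C8.Law421BirthS RhIdea6.G19.W07C11.Seam
open RhW08.Round1 RhW08.StSwap RhW08.Round2 RhW08.QuadW RhW08.SuccB RhW08.SuccSplit
open RhW08.Lens1Pinning (NoTallerToucher)
open ComplexConjugate
open RhW08.Lens1ArcSign (ascStarts ArcCountLaw pinning_of_arcCount_cofinite)

/-- The hypothesis BUNDLE of (ii″) at the data `(T, b, t, Z, H)` (the law's binders after the frame, conjoined). -/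
def ToothLiftData (θ κ₁ μ ρ η : ℝ) (f : ℂ → ℂ) (x₀ s hmax R Hs : ℝ) (B j : ℕ) (T b : ℂ) (t : ℝ) (Z : Multiset ℂ) (H : ℂ → ℂ) : Prop :=
  StTrkDQ η f x₀ s hmax R Hs B j T ∧ NoTallerToucher f j T ∧ (1 - θ) * T.im ≤ b.im ∧ b.im ≤ T.im ∧ |T.re - b.re| ≤ T.im + b.im ∧
    |t - T.re| ≤ T.im / 2 ∧ RestFactorZ f j Z H ∧ ({T, conj T, b, conj b, (t : ℂ)} : Multiset ℂ) ≤ Z ∧ (∀ q ∈ Z, q.im ≤ T.im) ∧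
    (∀ q : ℂ, |q.re - T.re| ≤ ρ * T.im → |q.im| ≤ T.im → H q ≠ 0) ∧ RVClassC κ₁ T H ∧ LinkMargin μ f j T

/-- (K) the law (ii″) applied to bundled data. -/
theorem toothLiftDichotomy_apply {θ κ₁ μ ρ : ℝ} (hN : ToothLiftDichotomyQ θ κ₁ μ ρ) {η : ℝ} {f : ℂ → ℂ} {x₀ s hmax R Hs : ℝ} {B j : ℕ}
    {T b : ℂ} {t : ℝ} {Z : Multiset ℂ} {H : ℂ → ℂ} (hE : EngineHyps5 2 η f x₀ s hmax R Hs B)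
    (hD : ToothLiftData θ κ₁ μ ρ η f x₀ s hmax R Hs B j T b t Z H) :
    (∃ w : ℂ, 0 < w.im ∧ iteratedDeriv (j + 1) f w = 0 ∧ NestedStep T w) ∨
    (∃ x : ℝ, |x - x₀| < ((j : ℝ) + 3) * R / 2 ∧ |x - T.re| ≤ 2 * T.im ∧ NLEventOf f j x) :=
  hN η f x₀ s hmax R Hs B hE j T b t Z H hD.1 hD.2.1 hD.2.2.1 hD.2.2.2.1 hD.2.2.2.2.1 hD.2.2.2.2.2.1 hD.2.2.2.2.2.2.1 hD.2.2.2.2.2.2.2.1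
    hD.2.2.2.2.2.2.2.2.1 hD.2.2.2.2.2.2.2.2.2.1 hD.2.2.2.2.2.2.2.2.2.2.1 hD.2.2.2.2.2.2.2.2.2.2.2

/-- A COMPANION of `T`: another upper zero of `f⁽ʲ⁾` in `T`'s CLOSED Jensen disc `|q − Re T| ≤ Im T` (any height).  `U₀ ≥ 2 ⟺ HasJensenCompanion` at a
SIMPLE top; at a MULTIPLE top `U₀ ≥ 2` while `HasJensenCompanion` may fail — harmless: branch 1 then holds by `w := T` and the consumer dispatches
multiple tops by `RhW08.NewtonDoor.succ_of_multiple` (C2 CHECK l.4200). -/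
def HasJensenCompanion (f : ℂ → ℂ) (j : ℕ) (T : ℂ) : Prop :=
  ∃ q : ℂ, iteratedDeriv j f q = 0 ∧ 0 < q.im ∧ q ≠ T ∧ ‖q - (T.re : ℂ)‖ ≤ T.im

/-- ★ (G1) L_comp IN DOOR CURRENCY (OPEN; (CA1111): THE typed target of L_comp — the guess «#asc ≤ 1» died on C6 RESULT-11's in-class frames with
#asc = 2, where the door holds with EQUALITY): data of (ii″) + a companion ⇒ the count law `ArcCountLaw f j T` (F :75), i.e. cofinitely
`#asc − #desc ≤ U₀ − 1`, a GLOBAL count (every companion in the OPEN ball `B(Re T, Im T + δ)` is a resource whatever its lens hosts; tight in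
3/1 163 frames of record; per-lens / charging forms are contradicted by the bank, C6 ADD-1 / (CA1112)). -/
def CompArcCountQ (θ κ₁ μ ρ : ℝ) : Prop :=
  ∀ (η : ℝ) (f : ℂ → ℂ) (x₀ s hmax R Hs : ℝ) (B : ℕ), EngineHyps5 2 η f x₀ s hmax R Hs B →
    ∀ (j : ℕ) (T b : ℂ) (t : ℝ) (Z : Multiset ℂ) (H : ℂ → ℂ), ToothLiftData θ κ₁ μ ρ η f x₀ s hmax R Hs B j T b t Z H → HasJensenCompanion f j T →
    ArcCountLaw f j T

/-- ★ (G2) ISOLATED LIFT (OPEN; L_iso = the residual corner): data of (ii″) and NO companion ⇒ the dichotomy of (ii″) itself (NL radius `2·Im T` —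
at the NEG-16 wall the count door is dead and only this radius carries the instance; mechanism: two-body identity + Hurwitz at the FOOT, using
the SIGN of (G3)).  Live population (critic l.10136): a partner `b ≠ T` inside `T`'s closed disc IS a companion, so here `b` touches from OUTSIDE
the closed disc (or `b = T`, a double top) — C2 RESULT-8's L_iso rows. -/
def IsoLiftQ (θ κ₁ μ ρ : ℝ) : Prop :=
  ∀ (η : ℝ) (f : ℂ → ℂ) (x₀ s hmax R Hs : ℝ) (B : ℕ), EngineHyps5 2 η f x₀ s hmax R Hs B →
    ∀ (j : ℕ) (T b : ℂ) (t : ℝ) (Z : Multiset ℂ) (H : ℂ → ℂ), ToothLiftData θ κ₁ μ ρ η f x₀ s hmax R Hs B j T b t Z H → ¬ HasJensenCompanion f j T →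
    (∃ w : ℂ, 0 < w.im ∧ iteratedDeriv (j + 1) f w = 0 ∧ NestedStep T w) ∨
    (∃ x : ℝ, |x - x₀| < ((j : ℝ) + 3) * R / 2 ∧ |x - T.re| ≤ 2 * T.im ∧ NLEventOf f j x)

/-- (K) the door's output in (ii″)'s shape: a non-real nested critical point becomes an UPPER one by reflection (`NestedStep` is even in `Im w`),
an NL event in the closed base `|x − Re T| ≤ Im T` is strictly within `2·Im T`, hence in range (`nl_branch_of_strict`). -/
theorem branches_of_door {η : ℝ} {f : ℂ → ℂ} {x₀ s hmax R Hs : ℝ} {B j : ℕ} {T : ℂ} (hE : EngineHyps5 2 η f x₀ s hmax R Hs B)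
    (hT : StTrkDQ η f x₀ s hmax R Hs B j T)
    (h : (∃ w : ℂ, iteratedDeriv (j + 1) f w = 0 ∧ w.im ≠ 0 ∧ NestedStep T w) ∨ (∃ x : ℝ, |x - T.re| ≤ T.im ∧ NLEventOf f j x)) :
    (∃ w : ℂ, 0 < w.im ∧ iteratedDeriv (j + 1) f w = 0 ∧ NestedStep T w) ∨
    (∃ x : ℝ, |x - x₀| < ((j : ℝ) + 3) * R / 2 ∧ |x - T.re| ≤ 2 * T.im ∧ NLEventOf f j x) := by
  have hTim : 0 < T.im := hT.2.2.1
  rcases h with ⟨w, hw0, hwim, hn⟩ | ⟨x, hx, hNL⟩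
  · left
    rcases lt_or_gt_of_ne hwim with hneg | hpos
    · refine ⟨conj w, by simpa using hneg, ?_, ?_⟩
      · rw [Literature.NumberTheory.LFunctions.iteratedDeriv_conj_of_conj (Literature.Analysis.Complex.apply_conj_eq_conj hE.1 hE.2.1) (j + 1) w,
          hw0, map_zero]
      · unfold NestedStep at hn ⊢
        simpa using hn
    · exact ⟨w, hpos, hw0, hn⟩
  · right
    exact nl_branch_of_strict hE hT ⟨x, by linarith [abs_nonneg (x - T.re)], hNL⟩

/-- ★ (K) THE SPLIT IS EXHAUSTIVE AND WIRED: L_comp in door currency and L_iso give (ii″), through the proved conversion `pinning_of_arcCount_cofinite`. -/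
theorem toothLiftDichotomy_of_split {θ κ₁ μ ρ : ℝ} (hC : CompArcCountQ θ κ₁ μ ρ) (hI : IsoLiftQ θ κ₁ μ ρ) : ToothLiftDichotomyQ θ κ₁ μ ρ := by
  intro η f x₀ s hmax R Hs B hE j T b t Z H hT hN hb1 hb2 ht hn hZ hsub hcap hbox hRV hL
  have hD : ToothLiftData θ κ₁ μ ρ η f x₀ s hmax R Hs B j T b t Z H := ⟨hT, hN, hb1, hb2, ht, hn, hZ, hsub, hcap, hbox, hRV, hL⟩
  by_cases hq : HasJensenCompanion f j T
  · exact branches_of_door hE hT (pinning_of_arcCount_cofinite hE hT.2.1 hT.2.2.1 (hC η f x₀ s hmax R Hs B hE j T b t Z H hD hq))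
  · exact hI η f x₀ s hmax R Hs B hE j T b t Z H hD hq

/-! ### (G3) the SIGN LAW as a DISCHARGE TARGET (C2 RESULT-7 / ADD l.10110/l.10113: `RVClassC` is sign-blind; in a LEGAL frame the rest has
order < 2, `(H′/H)′ = −Σ_q m_q/(z − q)²` by Hadamard, and every unpeeled conjugate pair admitted by NoTallerToucher + box + cap is DEFOCUSING on
`T`'s closed half-disc).  `RVDefocusC` is C2's scratch def VERBATIM (`HOME/rh-idea-2/g58/out/Defocus.lean.txt` 41f0a401, ns `RhW08.C2Sketch`);
`DefocusOfFrameQ` says the landed binders of (ii″)/(iii″) already DISCHARGE it on a frame — so the prover of (iii″)/(G2) may invoke the sign, and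
the laws need no new binder (weakest-law rule; RULED (CA1110)(2)).  OPEN (M: Hadamard genus ≤ 1 + per-pair geometry). -/

/-- C2's SIGNED rest class (verbatim from `Defocus.lean.txt` 41f0a401): zero-free and DEFOCUSING on `T`'s closed upper half-disc. -/
def RVDefocusC (T : ℂ) (H : ℂ → ℂ) : Prop :=
  ∀ z : ℂ, (z.re - T.re) ^ 2 + z.im ^ 2 ≤ T.im ^ 2 → 0 ≤ z.im → H z ≠ 0 ∧ (deriv (fun w => deriv H w / H w) z).re ≤ 0

/-- ★ (G3) DEFOCUS OF FRAME (OPEN discharge target; hypotheses EXACTLY C2 ADD-2 (1) / (CA1110)(2)): on a legal frame (order < 2), a rest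
factor `H` peeled off a conj-closed multiset of zeros of `f⁽ʲ⁾`, zero-free in the box `|Re q − Re T| ≤ ρ·Im T, |Im q| ≤ Im T`, under
`NoTallerToucher f j T`, is DEFOCUSING on `T`'s closed upper half-disc.  The box covers the half-disc from `ρ ≥ 1`, but the SIGN LAW needs
`ρ ≥ 2` (false on local models for `1 ≤ ρ < 2`: a real zero or low pair just outside the box focuses the foot arc — C2 CHECK l.4200, critic
l.10136); OF RECORD `ρ = 5`, sharp `ρ = 2`; RULE (CA1113): no instance below `ρ = 2` is ever cut.  Per-type atoms: real / low zeros outside the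
box are one-liners; the taller PAIR is the genuine two-term inequality (its lower member alone can focus near the flank; bench minimum ≡ 0 at
the touching-limit foot); WITHOUT `NoTallerToucher` the statement is false (a pair straight above `T`). -/
def DefocusOfFrameQ (ρ : ℝ) : Prop :=
  ∀ (η : ℝ) (f : ℂ → ℂ) (x₀ s hmax R Hs : ℝ) (B : ℕ), EngineHyps5 2 η f x₀ s hmax R Hs B →
    ∀ (j : ℕ) (T : ℂ) (Z : Multiset ℂ) (H : ℂ → ℂ), 0 < T.im → NoTallerToucher f j T → RestFactorZ f j Z H →
    (∀ q : ℂ, |q.re - T.re| ≤ ρ * T.im → |q.im| ≤ T.im → H q ≠ 0) → RVDefocusC T H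

example : Prop := DefocusOfFrameQ 5

-- instances of record (registry (ii″) parameters θ = 1/10, κ₁ = 2/5, μ = 0, ρ = 5)
example : Prop := IsoLiftQ (1 / 10) (2 / 5) 0 5
example : Prop := CompArcCountQ (1 / 10) (2 / 5) 0 5

end RhW08.Lens1ToothNestUmbrella
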